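import Literature.Analysis.FluidPDE.TorusNSBeiraoDaVeigaCriterion
import Literature.Analysis.FluidPDE.MillerMiddleEigenvalueTorus
import HarnessLib

/-!
# Miller's middle-eigenvalue criterion `λ₂⁺ ∈ L^p(0,T; L^q)`, `2/p + 3/q = 2`, `3/2 < q < ∞`, for
# classical Navier–Stokes solutions on `T³` (continuation form)

Analysis/FluidPDE proof file (theorems only; no definitions, no named facts).

Search for candidate a priori estimates; no regularity claim. Sequel of
`MillerMiddleEigenvalueTorus.lean` (Lemma 5.1 and the `q = ∞` Grönwall bound) and of
`TorusNSEnstrophyContinuation.lean` (`q = ∞` continuation). Here the remaining range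
`3/2 < q < ∞` of E. Miller, *A regularity criterion for the Navier–Stokes equation involving only
the middle eigenvalue of the strain tensor*, Arch. Ration. Mech. Anal. 235 (2020) 99–139, Thm 1.1 =
Thm 5.2 ("Let `u ∈ C([0,T];Ḣ¹)` … `λ₁ ≤ λ₂ ≤ λ₃` the eigenvalues of the strain tensor
`S = ∇_{sym}u`, `λ₂⁺ = max{λ₂, 0}`. If `2/p + 3/q = 2`, with `3/2 < q ≤ +∞`, then
`‖u(T)‖²_{Ḣ¹} ≤ ‖u⁰‖²_{Ḣ¹} exp(C_q∫₀ᵀ‖λ₂⁺‖^p_{L^q})` … if `T_max < +∞` then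
`∫₀^{T_max}‖λ₂⁺‖^p_{L^q} = +∞`"; p. 6: "while we have proven our results on the whole space,
they apply equally on the torus") is PROVED on the unit torus `T^d`, `card d = 3`, in continuation
form for classical solutions with mean-zero slices, following the printed proof (p. 16–17):
`∂ₜ‖S‖₂² ≤ −2ν‖∇S‖² + 2∫λ₂⁺|S|²` (Lemma 5.1 + the isometry; tree:
`hasDerivWithinAt_torusEnstrophy_det`, `Miller2019.neg_det_le_half_normSq_mul_posPart_middleEigenvalue`),
Hölder `∫λ₂⁺|S|² ≤ ‖λ₂⁺‖_q ‖S‖²_{2q/(q−1)}`, the Sobolev/interpolation bound of `‖S‖_{2q/(q−1)}`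
between `L²` and `L⁶` (here through `|S| ≤ |∇u|` pointwise and the tree's `L²`–`L⁶` interpolation
and Sobolev step for `|∇u|`), Young's inequality with exponents `p` and `b = 2q/3`, Grönwall.

* `Torus.exists_enstrophyFlux_le_of_middleEigenvalue_Lq_le` — the flux bound: for `3/2 < q` and
  `ν > 0` there is `K ≥ 0` such that for every smooth divergence-free `v`, every continuous
  `Λ ≥ 0` on `T³` dominating the middle eigenvalue of the strain of `v` pointwise, and every
  `N ≥ (∫Λ^q)^{1/q}`: `−ν‖Δv‖₂² + ∫⟪(v·∇)v, Δv⟫ ≤ K N^{2q/(2q−3)} ‖∇v‖₂²`.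
* `Torus.classicalNS_continuation_of_middleEigenvalue_Lq_rpow_integral_le` — **Miller's criterion
  on `T³`, `3/2 < q < ∞`, continuation form**: a time-continuous `N(t) ≥ ‖Λ(t)‖_{L^q}` for a
  continuous pointwise majorant field `Λ(t, ·) ≥ max(λ₂(t, ·), 0)` with `∫₀ᵗ N^{2q/(2q−3)} ≤ I`
  (`p = 2q/(2q−3)`, `2/p + 3/q = 2`) gives continuation past `T`.

Scope (faithfulness): classical solutions with mean-zero slices on the unit torus; the `L^q`
hypothesis is placed on a CONTINUOUS pointwise majorant field `Λ(t,x) ≥ λ₂⁺(t,x)` (Mathlib has no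
continuity theorem for sorted eigenvalues of a continuous symmetric matrix field, so `λ₂⁺` itself is
not integrated; any continuous majorant, e.g. a mollified `λ₂⁺ + ε`, may be used), with a
continuous-in-time majorant `N` of its `L^q` norm and bounded primitive of `N^p` in place of
`λ₂⁺ ∈ L^p_t L^q_x`; `q = ∞` is `Torus.classicalNS_continuation_of_middleEigenvalue_integral_le`;
`q = 3/2` is open in print ("an open question at the other boundary case") and not claimed.

## Mathlib / tree search

Tree (used): `Torus.IsClassicalNSSolutionOn.hasDerivWithinAt_torusEnstrophy_det`
(`TorusEnstrophyStrainIdentity`), `Miller2019.neg_det_le_half_normSq_mul_posPart_middleEigenvalue`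
(`MillerMiddleEigenvalueTorus`), `Torus.integral_rpow_le_interpolate_two_six'`,
`Torus.exists_integral_gradSq_cube_le_laplacianSq_cube`, `Torus.classicalNS_continuation_of_enstrophyFlux_le`
(this seat's torus criteria files); Mathlib `Real.geom_mean_le_arith_mean2_weighted`,
`integral_mul_le_Lp_mul_Lq_of_nonneg`. Searched: `middleEigenvalue.*Lq|eigenvalues₀.*rpow` — nothing.

## References

* [Miller2019] E. Miller, Arch. Ration. Mech. Anal. 235 (2020) 99–139 = arXiv:1710.05569, Thm 1.1 /
  Thm 5.2 with proof (held text pp. 5, 16–17), torus remark p. 6.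
* [RobinsonRodrigoSadowskiCUP2016] Lemma 6.11 (the continuation step); Lemma 8.16 (interpolation).
-/

noncomputable section

open Set MeasureTheory intervalIntegral Filter Real Matrix
open scoped InnerProductSpace RealInnerProductSpace Topology ENNReal

namespace Literature.Analysis.FluidPDE

open Literature.Analysis.FunctionSpaces

variable {d : Type*} [Fintype d] [DecidableEq d]

omit [DecidableEq d] in
/-- Hölder for continuous nonnegative functions on `T^d` with real conjugate exponents. [folklore] -/
private theorem integral_mul_le_rpow'' {f g : UnitAddTorus d → ℝ} (hf : Continuous f)
    (hg : Continuous g) (hf0 : ∀ x, 0 ≤ f x) (hg0 : ∀ x, 0 ≤ g x) {p q : ℝ}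
    (hpq : p.HolderConjugate q) :
    ∫ x, f x * g x ≤ (∫ x, f x ^ p) ^ (1 / p) * (∫ x, g x ^ q) ^ (1 / q) :=
  integral_mul_le_Lp_mul_Lq_of_nonneg (μ := volume) hpq (ae_of_all _ hf0) (ae_of_all _ hg0)
    (hf.memLp_of_hasCompactSupport (HasCompactSupport.of_compactSpace f))
    (hg.memLp_of_hasCompactSupport (HasCompactSupport.of_compactSpace g))

omit [Fintype d] [DecidableEq d] in
/-- The Young/AM–GM absorption: for `ν > 0`, weights `α, β > 0` with `α + β = 1` and
`M, G, P ≥ 0`, `−νP + M G^α P^β ≤ α (M^{1/α} ν^{−β/α}) G`. [folklore] -/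
private theorem flux_amgm' {ν α β M G P : ℝ} (hν : 0 < ν) (hα0 : 0 < α) (hβ0 : 0 < β)
    (hαβ : α + β = 1) (hM0 : 0 ≤ M) (hG0 : 0 ≤ G) (hP0 : 0 ≤ P) :
    -ν * P + M * G ^ α * P ^ β ≤ α * (M ^ α⁻¹ * (ν ^ (β / α))⁻¹) * G := by
  set X : ℝ := M ^ α⁻¹ * (ν ^ (β / α))⁻¹ * G with hX
  set Y : ℝ := ν * P with hY
  have hX0 : 0 ≤ X := by positivity
  have hY0 : 0 ≤ Y := by positivity
  have hAMGM := Real.geom_mean_le_arith_mean2_weighted hα0.le hβ0.le hX0 hY0 hαβ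
  have hXα : X ^ α = M * (ν ^ β)⁻¹ * G ^ α := by
    rw [hX, Real.mul_rpow (by positivity) hG0, Real.mul_rpow (by positivity) (by positivity),
      Real.inv_rpow (by positivity), ← Real.rpow_mul hν.le, Real.rpow_inv_rpow hM0 hα0.ne']
    congr 2
    rw [div_mul_cancel₀ β hα0.ne']
  have hYβ : Y ^ β = ν ^ β * P ^ β := by rw [hY, Real.mul_rpow hν.le hP0]
  have hprod : X ^ α * Y ^ β = M * G ^ α * P ^ β := by
    rw [hXα, hYβ]
    have hνβ : (ν ^ β)⁻¹ * ν ^ β = 1 := inv_mul_cancel₀ (Real.rpow_pos_of_pos hν β).ne'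
    calc M * (ν ^ β)⁻¹ * G ^ α * (ν ^ β * P ^ β)
        = M * ((ν ^ β)⁻¹ * ν ^ β) * G ^ α * P ^ β := by ring
      _ = M * G ^ α * P ^ β := by rw [hνβ, mul_one]
  rw [hprod] at hAMGM
  have hβ1 : β ≤ 1 := by linarith
  have hβY : β * Y ≤ Y := mul_le_of_le_one_left hY0 hβ1
  have hXdef : α * X = α * (M ^ α⁻¹ * (ν ^ (β / α))⁻¹) * G := by rw [hX]; ring
  rw [← hXdef]
  linarith

/-! ### Pointwise: Lemma 5.1 with a majorant, and `|S|² ≤ |∇v|²` -/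

/-- **Lemma 5.1 with a pointwise majorant**: for a smooth divergence-free `v` on `T^d`,
`card d = 3`, at a point `x` where the middle eigenvalue of the strain
`S(x) = ½((∂ⱼv)ᵢ + (∂ᵢv)ⱼ)` is `≤ L` with `0 ≤ L`,
`−4 det S(x) ≤ 2 L ∑ᵢⱼ S(x)ᵢⱼ² ≤ 2 L ∑ⱼ ‖∂ⱼv(x)‖²` (Miller 2019, Lemma 5.1:
"`−det(S) ≤ ½|S|²λ₂⁺`", and `|S|² ≤ |∇v|²` for the symmetric part).
[cite: Miller2019, Lemma 5.1] -/
theorem Torus.neg_four_mul_det_strain_le_majorant (hd : Fintype.card d = 3)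
    {v : UnitAddTorus d → EuclideanSpace ℝ d} (hv : Torus.IsSmooth v) (hdiv : Torus.IsDivFree v)
    (x : UnitAddTorus d) {L : ℝ} (hL0 : 0 ≤ L)
    (hL : ∀ hx : (Matrix.of fun i j =>
        (Torus.partialDeriv j v x i + Torus.partialDeriv i v x j) / 2).IsHermitian,
        hx.eigenvalues₀ (Fin.cast hd.symm 1) ≤ L) :
    -4 * (Matrix.of fun i j => (Torus.partialDeriv j v x i + Torus.partialDeriv i v x j) / 2).det ≤
      2 * L * ∑ j, ‖Torus.partialDeriv j v x‖ ^ 2 := by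
  set Sd : Matrix d d ℝ := Matrix.of fun i j =>
    (Torus.partialDeriv j v x i + Torus.partialDeriv i v x j) / 2 with hSd
  have hsym : Sd.IsSymm := by
    refine Matrix.IsSymm.ext fun i j => ?_
    simp only [hSd, Matrix.of_apply]; ring
  have htr : Sd.trace = 0 := by
    simp only [Matrix.trace, Matrix.diag, hSd, Matrix.of_apply]
    have h1 : ∑ i, (Torus.partialDeriv i v x i + Torus.partialDeriv i v x i) / 2 =
        ∑ i, Torus.partialDeriv i v x i := Finset.sum_congr rfl fun i _ => by ring
    rw [h1, ← Torus.divergence_eq_sum_partialDeriv_apply (hv.isContDiff (by simp)) x]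
    exact hdiv x
  have h51 := Miller2019.neg_det_le_half_normSq_mul_posPart_middleEigenvalue hd Sd hsym htr
  have hmax : max ((Matrix.isHermitian_iff_isSymm.mpr hsym).eigenvalues₀ (Fin.cast hd.symm 1)) 0
      ≤ L := max_le (hL _) hL0
  have hF0 : 0 ≤ ∑ i, ∑ j, Sd i j ^ 2 :=
    Finset.sum_nonneg fun i _ => Finset.sum_nonneg fun j _ => sq_nonneg _
  -- `∑ᵢⱼ Sᵢⱼ² ≤ ∑ⱼ ‖∂ⱼv‖²`
  have hFle : ∑ i, ∑ j, Sd i j ^ 2 ≤ ∑ j, ‖Torus.partialDeriv j v x‖ ^ 2 := by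
    have hnorm : ∀ j, ‖Torus.partialDeriv j v x‖ ^ 2 = ∑ i, (Torus.partialDeriv j v x i) ^ 2 := by
      intro j
      rw [EuclideanSpace.norm_sq_eq]
      exact Finset.sum_congr rfl fun i _ => by rw [Real.norm_eq_abs, sq_abs]
    simp only [hnorm, hSd, Matrix.of_apply]
    have key : ∀ i j, ((Torus.partialDeriv j v x i + Torus.partialDeriv i v x j) / 2) ^ 2 ≤
        ((Torus.partialDeriv j v x i) ^ 2 + (Torus.partialDeriv i v x j) ^ 2) / 2 := by
      intro i j
      nlinarith [sq_nonneg (Torus.partialDeriv j v x i - Torus.partialDeriv i v x j)]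
    calc ∑ i, ∑ j, ((Torus.partialDeriv j v x i + Torus.partialDeriv i v x j) / 2) ^ 2
        ≤ ∑ i, ∑ j, ((Torus.partialDeriv j v x i) ^ 2 + (Torus.partialDeriv i v x j) ^ 2) / 2 :=
          Finset.sum_le_sum fun i _ => Finset.sum_le_sum fun j _ => key i j
      _ = ∑ j, ∑ i, (Torus.partialDeriv j v x i) ^ 2 := by
          have hc : ∑ i, ∑ j, (Torus.partialDeriv i v x j) ^ 2 =
              ∑ i, ∑ j, (Torus.partialDeriv j v x i) ^ 2 := Finset.sum_comm
          simp only [Finset.sum_add_distrib, ← Finset.sum_div, add_div]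
          rw [hc, Finset.sum_comm]
          ring
  have h2 : 2⁻¹ * (∑ i, ∑ j, Sd i j ^ 2) * max ((Matrix.isHermitian_iff_isSymm.mpr hsym).eigenvalues₀
      (Fin.cast hd.symm 1)) 0 ≤ 2⁻¹ * (∑ j, ‖Torus.partialDeriv j v x‖ ^ 2) * L :=
    mul_le_mul (mul_le_mul_of_nonneg_left hFle (by norm_num)) hmax (le_max_right _ _)
      (by positivity)
  linarith

/-! ### The flux bound under an `L^q` bound on a middle-eigenvalue majorant -/

/-- **The enstrophy flux under `‖λ₂⁺‖_{L^q} ≤ N`, `3/2 < q < ∞`** (Miller 2019, proof of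
Thm 5.2: `∂ₜ‖S‖² ≤ −2ν‖S‖²_{Ḣ¹} + C_q(‖λ₂⁺‖_q‖S‖^{2−3/q})^p + …`, Young with `p` and `b = 2q/3`):
on `T^d`, `card d = 3`, for `3/2 < q` and `ν > 0` there is `K ≥ 0` such that for every smooth
divergence-free `v`, every continuous `Λ ≥ 0` on `T^d` dominating the middle eigenvalue of the
strain of `v` at every point, and every `N ≥ (∫Λ^q)^{1/q}`,
`−ν‖Δv‖₂² + ∫⟪(v·∇)v, Δv⟫ ≤ K N^{2q/(2q−3)} ‖∇v‖₂²`. (Here `−ν‖Δv‖₂² + ∫⟪(v·∇)v, Δv⟫ =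
−ν‖Δv‖₂² − 4∫det S` for divergence-free `v`, `TorusEnstrophyStrainIdentity`.)
[cite: Miller2019, Thm 5.2 (proof, pp. 16–17)] -/
theorem Torus.exists_enstrophyFlux_le_of_middleEigenvalue_Lq_le (hd : Fintype.card d = 3)
    {q ν : ℝ} (hq : 3 / 2 < q) (hν : 0 < ν) :
    ∃ K : ℝ, 0 ≤ K ∧ ∀ (v : UnitAddTorus d → EuclideanSpace ℝ d), Torus.IsSmooth v →
      Torus.IsDivFree v → ∀ (Λ : UnitAddTorus d → ℝ), Continuous Λ → (∀ x, 0 ≤ Λ x) →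
      (∀ x, ∀ hx : (Matrix.of fun i j =>
        (Torus.partialDeriv j v x i + Torus.partialDeriv i v x j) / 2).IsHermitian,
        hx.eigenvalues₀ (Fin.cast hd.symm 1) ≤ Λ x) →
      ∀ N : ℝ, 0 ≤ N → (∫ x, Λ x ^ q) ^ (1 / q) ≤ N →
        -ν * (∫ x, ‖Torus.laplacian v x‖ ^ 2) + ∫ x, ⟪Torus.convect v v x, Torus.laplacian v x⟫ ≤
          K * N ^ (2 * q / (2 * q - 3)) * Torus.gradNormSq v := by
  obtain ⟨C₆, hC₆0, hC₆⟩ := Torus.exists_integral_gradSq_cube_le_laplacianSq_cube (d := d) hd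
  have hq0 : 0 < q := by linarith
  have hq1 : 0 < q - 1 := by linarith
  have h2q3 : 0 < 2 * q - 3 := by linarith
  -- weights and exponents
  set α : ℝ := (2 * q - 3) / (2 * q) with hα
  set β : ℝ := 3 / (2 * q) with hβ
  set r : ℝ := 2 * q / (2 * q - 3) with hr
  have hα0 : 0 < α := by rw [hα]; positivity
  have hβ0 : 0 < β := by rw [hβ]; positivity
  have hαβ : α + β = 1 := by rw [hα, hβ]; field_simp; ring
  have hαr : α⁻¹ = r := by rw [hα, hr, inv_div]
  set c : ℝ := 2 * C₆ ^ (1 / (2 * q)) with hc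
  have hc0 : 0 ≤ c := by positivity
  set K : ℝ := α * (c ^ r * (ν ^ (β / α))⁻¹) with hK
  have hK0 : 0 ≤ K := by positivity
  refine ⟨K, hK0, fun v hv hdiv Λ hΛc hΛ0 hΛ N hN0 hN => ?_⟩
  -- notation
  set f : UnitAddTorus d → ℝ := fun x => Real.sqrt (∑ j, ‖Torus.partialDeriv j v x‖ ^ 2) with hf
  set θ : UnitAddTorus d → ℝ := fun x => ∑ j, ‖Torus.partialDeriv j v x‖ ^ 2 with hθ
  set G : ℝ := Torus.gradNormSq v with hGdef
  set P : ℝ := ∫ x, ‖Torus.laplacian v x‖ ^ 2 with hPdef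
  have hG0 : 0 ≤ G := Torus.gradNormSq_nonneg _
  have hP0 : 0 ≤ P := integral_nonneg fun x => sq_nonneg _
  have hθ0 : ∀ x, 0 ≤ θ x := fun x => Finset.sum_nonneg fun j _ => sq_nonneg _
  have hDc : ∀ i, Continuous fun x => Torus.partialDeriv i v x :=
    fun i => (hv.partialDeriv i).continuous
  have hθc : Continuous θ := continuous_finsetSum _ fun i _ => ((hDc i).norm).pow 2
  have hfc : Continuous f := Real.continuous_sqrt.comp hθc
  have hf0 : ∀ x, 0 ≤ f x := fun x => Real.sqrt_nonneg _
  have hf2 : ∀ x, f x ^ 2 = θ x := fun x => Real.sq_sqrt (hθ0 x)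
  have hG : ∫ x, f x ^ 2 = G := by simp only [hf2, hθ, hGdef, Torus.gradNormSq]
  have hf6 : ∫ x, f x ^ 6 ≤ C₆ * P ^ 3 := by
    have e : ∀ x, f x ^ 6 = (∑ j, ‖Torus.partialDeriv j v x‖ ^ 2) ^ 3 := fun x => by
      rw [show f x ^ 6 = (f x ^ 2) ^ 3 by ring, hf2]
    simp only [e]
    exact hC₆ v hv
  have hI6 : 0 ≤ ∫ x, f x ^ 6 := integral_nonneg fun x => pow_nonneg (hf0 x) 6
  -- Step 1: the flux equals `-νP - 4∫det S` and `-4 det S ≤ 2 Λ θ` pointwise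
  set Sd : UnitAddTorus d → Matrix d d ℝ := fun x => Matrix.of fun i j =>
    (Torus.partialDeriv j v x i + Torus.partialDeriv i v x j) / 2 with hSd
  have hid : ∫ x, ⟪Torus.convect v v x, Torus.laplacian v x⟫ = -4 * ∫ x, (Sd x).det := by
    have h1 := integral_stretching_eq_four_mul_integral_det_strain hd hv hdiv
    have h2 := Torus.integral_inner_laplacian_convect_self_eq_neg hv hdiv
    have hsymm : ∫ x, ⟪Torus.convect v v x, Torus.laplacian v x⟫ =
        ∫ x, ⟪Torus.laplacian v x, Torus.convect v v x⟫ :=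
      integral_congr_ae (ae_of_all _ fun x => real_inner_comm _ _)
    rw [hsymm, h2, h1]
    ring
  have hpt : ∀ x, -4 * (Sd x).det ≤ 2 * (Λ x * θ x) := by
    intro x
    have h := Torus.neg_four_mul_det_strain_le_majorant hd hv hdiv x (hΛ0 x) (hΛ x)
    simp only [hSd, hθ]
    linarith
  have hSdc : Continuous Sd := by
    refine continuous_matrix fun i j => ?_
    simp only [hSd, Matrix.of_apply]
    exact (((hv.partialDeriv j).apply i).continuous.add
      ((hv.partialDeriv i).apply j).continuous).div_const _
  have hdetI : Integrable (fun x => (Sd x).det) volume := hSdc.matrix_det.integrable_unitAddTorus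
  have hΛθI : Integrable (fun x => 2 * (Λ x * θ x)) volume :=
    ((hΛc.mul hθc).integrable_unitAddTorus).const_mul 2
  have hstep1 : ∫ x, ⟪Torus.convect v v x, Torus.laplacian v x⟫ ≤ 2 * ∫ x, Λ x * θ x := by
    rw [hid, ← MeasureTheory.integral_const_mul, ← MeasureTheory.integral_const_mul]
    exact integral_mono (hdetI.const_mul _) hΛθI hpt
  -- Step 2: Hölder `∫ Λ θ ≤ (∫Λ^q)^{1/q} (∫ θ^{q/(q-1)})^{(q-1)/q}`
  have hpq : q.HolderConjugate (q / (q - 1)) := by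
    refine Real.holderConjugate_iff.2 ⟨by linarith, ?_⟩
    field_simp
    ring
  have hH := integral_mul_le_rpow'' (f := Λ) (g := θ) hΛc hθc hΛ0 hθ0 hpq
  have eθ : ∀ x, θ x ^ (q / (q - 1)) = f x ^ (2 * q / (q - 1)) := fun x => by
    rw [← hf2 x, show (f x ^ 2 : ℝ) = f x ^ (2 : ℝ) by rw [Real.rpow_two], ← Real.rpow_mul (hf0 x)]
    congr 1; field_simp
  simp only [eθ] at hH
  rw [one_div_div] at hH
  -- Step 3: interpolation with `q̃ = 2q/(q-1) ∈ (2, 6)` and the Sobolev step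
  have hq2 : 2 < 2 * q / (q - 1) := by rw [lt_div_iff₀ hq1]; linarith
  have hq6 : 2 * q / (q - 1) < 6 := by rw [div_lt_iff₀ hq1]; linarith
  have hI := Torus.integral_rpow_le_interpolate_two_six' hq2 hq6 hfc hf0
  rw [hG] at hI
  set Fq : ℝ := ∫ x, f x ^ (2 * q / (q - 1)) with hFq
  have hFq0 : 0 ≤ Fq := integral_nonneg fun x => Real.rpow_nonneg (hf0 x) _
  have x6q : (6 - 2 * q / (q - 1)) / 4 = (2 * q - 3) / (2 * (q - 1)) := by field_simp; ring
  have xq2 : (2 * q / (q - 1) - 2) / 4 = 1 / (2 * (q - 1)) := by field_simp; ring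
  rw [x6q, xq2] at hI
  have hFq_le : Fq ^ ((q - 1) / q) ≤ C₆ ^ (1 / (2 * q)) * G ^ α * P ^ β := by
    have h1 : Fq ≤ G ^ ((2 * q - 3) / (2 * (q - 1))) * (C₆ * P ^ 3) ^ (1 / (2 * (q - 1))) := by
      refine hI.trans (mul_le_mul_of_nonneg_left ?_ (Real.rpow_nonneg hG0 _))
      exact Real.rpow_le_rpow hI6 hf6 (by positivity)
    have h2 := Real.rpow_le_rpow hFq0 h1 (by positivity : (0 : ℝ) ≤ (q - 1) / q)
    refine h2.trans (le_of_eq ?_)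
    have hCP : 0 ≤ C₆ * P ^ 3 := by positivity
    rw [Real.mul_rpow (Real.rpow_nonneg hG0 _) (Real.rpow_nonneg hCP _), ← Real.rpow_mul hG0,
      ← Real.rpow_mul hCP, Real.mul_rpow hC₆0 (by positivity),
      show (P ^ 3 : ℝ) = P ^ (3 : ℝ) by norm_cast, ← Real.rpow_mul hP0]
    have x1 : (2 * q - 3) / (2 * (q - 1)) * ((q - 1) / q) = α := by rw [hα]; field_simp
    have x2 : 1 / (2 * (q - 1)) * ((q - 1) / q) = 1 / (2 * q) := by field_simp
    have x3 : (3 : ℝ) * (1 / (2 * q)) = β := by rw [hβ]; ring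
    rw [x1, x2, x3]
    ring
  -- Step 4: `flux ≤ -νP + (c N) G^α P^β`, then AM–GM
  have hT2 : ∫ x, ⟪Torus.convect v v x, Torus.laplacian v x⟫ ≤ (c * N) * G ^ α * P ^ β := by
    refine hstep1.trans ?_
    calc 2 * ∫ x, Λ x * θ x ≤ 2 * ((∫ x, Λ x ^ q) ^ (1 / q) * Fq ^ ((q - 1) / q)) :=
          mul_le_mul_of_nonneg_left hH (by norm_num)
      _ ≤ 2 * (N * (C₆ ^ (1 / (2 * q)) * G ^ α * P ^ β)) := by
          refine mul_le_mul_of_nonneg_left ?_ (by norm_num)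
          exact mul_le_mul hN hFq_le (Real.rpow_nonneg hFq0 _) hN0
      _ = (c * N) * G ^ α * P ^ β := by rw [hc]; ring
  have hM0 : 0 ≤ c * N := mul_nonneg hc0 hN0
  have hmain := flux_amgm' hν hα0 hβ0 hαβ hM0 hG0 hP0 (M := c * N)
  have hKX : α * ((c * N) ^ α⁻¹ * (ν ^ (β / α))⁻¹) * G = K * N ^ r * G := by
    rw [hαr, hK, Real.mul_rpow hc0 hN0]
    ring
  calc -ν * (∫ x, ‖Torus.laplacian v x‖ ^ 2) + ∫ x, ⟪Torus.convect v v x, Torus.laplacian v x⟫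
      ≤ -ν * P + (c * N) * G ^ α * P ^ β := by rw [hPdef]; linarith [hT2]
    _ ≤ α * ((c * N) ^ α⁻¹ * (ν ^ (β / α))⁻¹) * G := hmain
    _ = K * N ^ (2 * q / (2 * q - 3)) * Torus.gradNormSq v := by rw [hKX]

/-! ### Miller's criterion on `T³`, `3/2 < q < ∞`, continuation form -/

/-- **Miller's middle-eigenvalue criterion `λ₂⁺ ∈ L^p(0,T;L^q)`, `2/p + 3/q = 2`, `3/2 < q < ∞`,
on `T³` (continuation form)** (Miller, ARMA 235 (2020), Thm 1.1 = Thm 5.2; torus remark p. 6).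
Let `(u, p)` be a classical solution of the unforced Navier–Stokes equations with `ν > 0` on
`[0, T) × T^d`, `card d = 3`, `T > 0`, with mean-zero velocity slices; let `3/2 < q`, let
`Λ(t, ·)` be, for every `t ∈ [0, T)`, a continuous nonnegative function on `T^d` dominating the
middle eigenvalue of the strain `S(t,x) = ½((∂ⱼu)ᵢ + (∂ᵢu)ⱼ)` (Mathlib's sorted `eigenvalues₀ 1`,
for every Hermitian witness) at every point, and let `N` be a continuous nonnegative function on
`[0, T)` with `(∫ Λ(t,x)^q dx)^{1/q} ≤ N(t)` and `∫₀ᵗ N^{2q/(2q−3)} ≤ I` for all `t ∈ [0, T)`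
(`p = 2q/(2q−3)`, `2/p + 3/q = 2`). Then the solution continues to a classical solution with
mean-zero slices on some `[0, T'] × T^d`, `T' > T`, equal to `u` on `[0, T)`
(`Torus.exists_enstrophyFlux_le_of_middleEigenvalue_Lq_le` + the Grönwall door; "it suffices to
prove the bound … applying Gronwall's inequality", Miller p. 16).
[cite: Miller2019, Thm 1.1 / Thm 5.2 (case 3/2 < q < ∞) and torus remark p. 6] -/
theorem Torus.classicalNS_continuation_of_middleEigenvalue_Lq_rpow_integral_le
    (hd : Fintype.card d = 3) {ν T q : ℝ} (hν : 0 < ν) (hT : 0 < T) (hq : 3 / 2 < q)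
    {u : ℝ → UnitAddTorus d → EuclideanSpace ℝ d} {p : ℝ → UnitAddTorus d → ℝ}
    (h : Torus.IsClassicalNSSolutionOn (Ico 0 T) ν 0 u p)
    (hmean : ∀ t ∈ Ico 0 T, Torus.HasZeroMean (u t)) {Λ : ℝ → UnitAddTorus d → ℝ}
    (hΛc : ∀ t ∈ Ico 0 T, Continuous (Λ t)) (hΛ0 : ∀ t ∈ Ico 0 T, ∀ x, 0 ≤ Λ t x)
    (hΛ : ∀ t ∈ Ico 0 T, ∀ x, ∀ hx : (Matrix.of fun i j =>
        (Torus.partialDeriv j (u t) x i + Torus.partialDeriv i (u t) x j) / 2).IsHermitian,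
        hx.eigenvalues₀ (Fin.cast hd.symm 1) ≤ Λ t x)
    {N : ℝ → ℝ} (hNc : ContinuousOn N (Ico 0 T)) (hN0 : ∀ t ∈ Ico 0 T, 0 ≤ N t)
    (hN : ∀ t ∈ Ico 0 T, (∫ x, Λ t x ^ q) ^ (1 / q) ≤ N t)
    {I : ℝ} (hI : ∀ t ∈ Ico 0 T, ∫ τ in (0 : ℝ)..t, N τ ^ (2 * q / (2 * q - 3)) ≤ I) :
    ∃ T' : ℝ, T < T' ∧ ∃ (u' : ℝ → UnitAddTorus d → EuclideanSpace ℝ d)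
      (p' : ℝ → UnitAddTorus d → ℝ), Torus.IsClassicalNSSolutionOn (Icc 0 T') ν 0 u' p' ∧
        (∀ t ∈ Icc 0 T', Torus.HasZeroMean (u' t)) ∧ ∀ t ∈ Ico 0 T, u' t = u t := by
  obtain ⟨K, hK0, hK⟩ := Torus.exists_enstrophyFlux_le_of_middleEigenvalue_Lq_le (d := d) hd hq hν
  have h2q3 : 0 < 2 * q - 3 := by linarith
  have hr0 : 0 ≤ 2 * q / (2 * q - 3) := by positivity
  refine Torus.classicalNS_continuation_of_enstrophyFlux_le hd hν hT h hmean
    (g := fun t => 2 * K * N t ^ (2 * q / (2 * q - 3)))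
    (continuousOn_const.mul (hNc.rpow_const fun t _ => Or.inr hr0)) (fun t ht => ?_)
    (I := 2 * K * I) (fun t ht => ?_)
  · have hut : Torus.IsSmooth (u t) := h.smooth_velocity.isSmooth_slice ht
    have h1 := hK (u t) hut (h.divFree t ht) (Λ t) (hΛc t ht) (hΛ0 t ht) (hΛ t ht) (N t)
      (hN0 t ht) (hN t ht)
    have h2 : K * N t ^ (2 * q / (2 * q - 3)) * Torus.gradNormSq (u t) =
        2 * K * N t ^ (2 * q / (2 * q - 3)) * (2⁻¹ * Torus.gradNormSq (u t)) := by ring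
    linarith
  · rw [intervalIntegral.integral_const_mul]
    exact mul_le_mul_of_nonneg_left (hI t ht) (by positivity)

end Literature.Analysis.FluidPDE

end
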